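import Literature.AlgebraicGeometry.Motives.StandardConjectures
import Literature.AlgebraicGeometry.Motives.AbelianVarietyExterior
import Literature.AlgebraicGeometry.Motives.AbelianVarietyProofs
import Literature.AlgebraicGeometry.Motives.CorrespondencesHyperplaneProofs
import Literature.AlgebraicGeometry.Motives.VarietiesProjectiveSpaceProofs
import HarnessLib

/-!
# Discharged fact: the standard conjecture of Lefschetz type for abelian varieties

`Literature.AlgebraicGeometry.Motives.StandardConjectures` records as a named fact (hodge.S29,
D-0014) `standardConjectureB_abelianVariety : Prop` — for a Weil cohomology theory `W` with the
hard Lefschetz property, an abelian variety `A` over `k` and a hyperplane class `η` on `A`,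
Grothendieck's standard conjecture of Lefschetz type `B(A)` holds in `θ`-form: for `i + r = dim A`
the inverse of `Lʳ : Hⁱ(A) ⥲ H²ᵍ⁻ⁱ(A)` is induced by an algebraic correspondence with
`ℚ`-coefficients (D. Lieberman, *Amer. J. Math.* 90 (1968); S. Kleiman, *Algebraic cycles and the
Weil conjectures* (1968), Appendix to §2, Thm. 2A11; S. Kleiman, *The standard conjectures* (1994),
4.3). This file **proves** it (`standardConjectureB_abelianVariety_holds`).

## The argument (formal in the axioms of `WeilCohomology`, given hard Lefschetz)

1. `A` is smooth projective of dimension `g = dim A`: the hyperplane class exhibits a projective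
   embedding (`AbelianVariety.isSmoothProjective_of_isProjectiveOver`); `ηᵍ ≠ 0`
   (`trace_pow_of_isHyperplaneClass`) and `η ∈ A¹(A)_ℚ`.
2. `H•(A)` is a graded bialgebra under `m*` (`AbelianVarietyHopf`), `[n]* = nᵈ` on `Hᵈ(A)` and
   `H•(A)` is generated by `H¹(A)` (`AbelianVarietyWeights`), so `H•(A) = Λ• H¹(A)`,
   `dim H¹(A) = 2g`, and the polarization class `ℓ = m*η - pr₁*η - pr₂*η ∈ A¹(A × A)_ℚ` has
   `± ℓⁱ` inducing a **bijective** operator `F : H²ᵍ⁻ⁱ(A) → Hⁱ(A)` (`AbelianVarietyExterior`,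
   `fourierOp_bijective`, `isAlgebraicOperator_fourierOp`) — the cohomological Fourier transform
   of Lieberman's proof (Kleiman 1968, 2A8–2A10).
3. `w = F ∘ Lʳ` is an algebraic automorphism of `Hⁱ(A)` (`IsAlgebraicOperator.comp_lefschetzPow`,
   hard Lefschetz); its positive powers are algebraic, so have rational traces by the Lefschetz
   trace formula (`exists_rat_trace_of_isAlgebraicOperator`); by Cayley–Hamilton with rational
   coefficients (`LinearMap.exists_inverse_eq_sum_ratCast_smul_pow`) `w⁻¹ = Σ qₘ wᵐ`, `qₘ ∈ ℚ`,
   so `id = Σ qₘ wᵐ⁺¹` and then `w⁻¹` are algebraic, and `θⁱ = w⁻¹ ∘ F` is the algebraic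
   two-sided inverse of `Lʳ`.

Depends only on (fields of `WeilCohomology`): the hypothesis `W.HasHardLefschetz`,
`bijective_kunnethMap`, `trace_externalCup`, `isPerfPair_cupPairing`, `finite_obj`,
`subsingleton_obj`, `bijective_trace`, `cup_assoc`, `cup_comm`, `one_cup`, `map_one`, `map_cup`,
`trace_pow_of_isHyperplaneClass`, `cup_mem_ratAlgebraicClasses`, `pullback_ratAlgebraicClasses_le`,
`cycleClass_of_coheight_eq_zero`, `trace_cycleClass`, `cycleClass_eq_zero_of_coheight_ne`,
`exists_isInducedBy_id`, `exists_isInducedBy_pullback`, `map_ratAlgebraicClasses_of_isInducedBy`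
(through `isAlgebraicGradedOp_comp_holds` and the trace formula), and the discharged facts
`IsSmoothProjective.tensor_holds`, `isSmoothProjective_unit_holds`,
`isSmoothProjective_projectiveSpace_holds`. The omitted compatibilities of the cycle map with
intersection products / push-forward of cycles are not used.

## References

* D. Lieberman, *Numerical and homological equivalence of algebraic cycles on Hodge manifolds*,
  Amer. J. Math. 90 (1968), 366–374.
* S. Kleiman, *Algebraic cycles and the Weil conjectures*, in: Dix exposés sur la cohomologie des
  schémas, North-Holland (1968), 359–386, Appendix to §2 (2A8–2A11). [Kleiman1968AlgebraicCycles]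
* S. Kleiman, *The standard conjectures*, Proc. Sympos. Pure Math. 55 (1994), 3–20, 4.3.
  [Kleiman1994]
-/

universe u v

open CategoryTheory AlgebraicGeometry MonoidalCategory CartesianMonoidalCategory Opposite
open scoped TensorProduct

noncomputable section

namespace Literature.AlgebraicGeometry.Motives

section Discharge

variable {k : Type u} [Field k] {K : Type v} [Field K] [CharZero K] {W : WeilCohomology k K}

/-- **Discharge of `standardConjectureB_abelianVariety` (hodge.S29): `B(A)` holds for abelian
varieties** (D. Lieberman, *Numerical and homological equivalence of algebraic cycles on Hodge
manifolds*, Amer. J. Math. 90 (1968), 366–374; S. Kleiman, *Algebraic cycles and the Weil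
conjectures* (1968), Appendix to §2, 2A11; S. Kleiman, *The standard conjectures* (1994), 4.3).
Under hard Lefschetz, for an abelian variety `A` over `k` and any hyperplane class `η` on `A`,
the inverse `θⁱ` of every hard-Lefschetz isomorphism `Lʳ : Hⁱ(A) → H²ᵍ⁻ⁱ(A)` (`g = dim A`,
`i + r = g`) is induced by an algebraic correspondence with `ℚ`-coefficients, for every Weil
cohomology theory `W`.

Proof (formal in the axioms of `WeilCohomology`, given hard Lefschetz). `A` is smooth projective
of dimension `g` (the hyperplane class exhibits a projective embedding;
`AbelianVariety.isSmoothProjective_of_isProjectiveOver`) and `ηᵍ ≠ 0`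
(`trace_pow_of_isHyperplaneClass`). By `AbelianVarietyHopf`/`AbelianVarietyWeights` and the
exterior-algebra structure above, `H•(A) = Λ• H¹(A)` with `dim H¹(A) = 2g`, and the polarization
class `ℓ = m*η - pr₁*η - pr₂*η ∈ A¹(A × A)_ℚ` has powers
`ℓⁱ = ± Σ_c pr₁* x_c ∪ pr₂* y_c` (`x`, `y` the products of a basis of `H¹(A)` and of its
polarization basis), so the rational algebraic class `± ℓⁱ` induces a **bijective** operator
`F : H²ᵍ⁻ⁱ(A) → Hⁱ(A)` (`fourierOp_bijective`; the Fourier transform of Lieberman's argument,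
Kleiman 2A8–2A10). Then `w = F ∘ Lʳ` is an algebraic automorphism of `Hⁱ(A)`
(`IsAlgebraicOperator.comp_lefschetzPow`); its positive powers are algebraic, hence have rational
traces (Lefschetz trace formula, `exists_rat_trace_of_isAlgebraicOperator`), so by Cayley–Hamilton
`w⁻¹ = Σ qₘ wᵐ` with `qₘ ∈ ℚ` (`LinearMap.exists_inverse_eq_sum_ratCast_smul_pow`); in particular
`id = Σ qₘ wᵐ⁺¹` is algebraic, then so is `w⁻¹`, and `θⁱ = w⁻¹ ∘ F` is the algebraic two-sided
inverse of `Lʳ` (hard Lefschetz). [cite: Kleiman1968AlgebraicCycles, Appendix to §2, Thm. 2A11] -/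
theorem standardConjectureB_abelianVariety_holds : standardConjectureB_abelianVariety (W := W) := by
  intro hL A η hη i r j h₁ h₂
  classical
  -- `A` is smooth projective of dimension `g`
  have hproj : IsProjectiveOver A.X := by
    obtain ⟨e, -, -, -, -⟩ := hη
    exact e.isProjectiveOver
  have hA : IsSmoothProjective A.dim A.X := A.isSmoothProjective_of_isProjectiveOver hproj
  set g := A.dim with hg
  -- `ηᵍ ≠ 0` and `η ∈ A¹(A)_ℚ`
  have hw : W.pow A.X η g ≠ 0 := by
    obtain ⟨d, hd, htr⟩ := W.trace_pow_of_isHyperplaneClass hA η hη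
    intro h0
    rw [h0, map_zero] at htr
    exact (Nat.cast_ne_zero.mpr (Nat.pos_iff_ne_zero.mp hd)) htr.symm
  have hηalg : η ∈ W.ratAlgebraicClasses A.X 1 := by
    obtain ⟨e, D, hD, -, rfl⟩ := hη
    exact W.pullback_ratAlgebraicClasses_le hA (isSmoothProjective_projectiveSpace_holds k e.n) e.ι 1
      ⟨_, W.algebraicLattice_le_ratAlgebraicClasses _ 1 (W.cycleMap_mem_algebraicLattice _ 1 hD), rfl⟩
  haveI := W.finite_obj hA 1
  haveI := W.finite_obj hA i
  let b := Module.finBasis K (W.obj A.X 1)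
  -- the algebraic isomorphism `F : Hʲ(A) → Hⁱ(A)` and `w = F ∘ Lʳ`
  have hij : j + i = 2 * g := by omega
  set F := W.fourierOp A hA hw b hij with hF
  have Falg : W.IsAlgebraicOperator g g F := W.isAlgebraicOperator_fourierOp A hA hw hηalg b hij
  have Fbij : Function.Bijective F := W.fourierOp_bijective A hA hw b hij
  have Lbij : Function.Bijective (W.lefschetzPow A.X η r i j h₂) := hL hA η hη i r j h₁ h₂
  set w : W.obj A.X i →ₗ[K] W.obj A.X i := F ∘ₗ W.lefschetzPow A.X η r i j h₂ with hwdef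
  have walg : W.IsAlgebraicOperator g g w := Falg.comp_lefschetzPow hA hA hη h₂
  have hunit : IsUnit w := (Module.End.isUnit_iff w).mpr (Fbij.comp Lbij)
  -- positive powers of `w` are algebraic, hence have rational traces
  have wpow : ∀ m : ℕ, W.IsAlgebraicOperator g g (w ^ (m + 1)) := by
    intro m
    induction m with
    | zero => simpa using walg
    | succ m ih =>
      rw [pow_succ, Module.End.mul_eq_comp]
      exact ih.comp hA hA hA walg
  have htr : ∀ m : ℕ, ∃ q : ℚ, LinearMap.trace K _ (w ^ (m + 1)) = q := fun m ↦
    W.exists_rat_trace_of_isAlgebraicOperator hA (wpow m)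
  -- Cayley–Hamilton with rational coefficients
  obtain ⟨q, hv, -⟩ := LinearMap.exists_inverse_eq_sum_ratCast_smul_pow w hunit htr
  set v : W.obj A.X i →ₗ[K] W.obj A.X i :=
    ∑ m ∈ Finset.range (Module.finrank K (W.obj A.X i)), ((q m : ℚ) : K) • w ^ m with hv'
  -- `id = v w = Σ qₘ wᵐ⁺¹` is algebraic
  have hid : W.IsAlgebraicOperator g g (LinearMap.id : W.obj A.X i →ₗ[K] W.obj A.X i) := by
    have : (LinearMap.id : W.obj A.X i →ₗ[K] W.obj A.X i) =
        ∑ m ∈ Finset.range (Module.finrank K (W.obj A.X i)), ((q m : ℚ) : K) • w ^ (m + 1) := by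
      rw [← Module.End.one_eq_id, ← hv, Finset.sum_mul]
      refine Finset.sum_congr rfl fun m _ ↦ ?_
      rw [smul_mul_assoc, ← pow_succ]
    rw [this]
    exact PreWeilCohomology.IsAlgebraicOperator.sum_ratCast_smul _ q fun m _ ↦ wpow m
  have valg : W.IsAlgebraicOperator g g v :=
    PreWeilCohomology.IsAlgebraicOperator.sum_ratCast_smul _ q fun m _ ↦ walg.pow hA hid m
  -- `θ = v ∘ F` is the algebraic two-sided inverse of `Lʳ`
  have hleft : (v ∘ₗ F) ∘ₗ W.lefschetzPow A.X η r i j h₂ = LinearMap.id := by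
    rw [LinearMap.comp_assoc, ← hwdef, ← Module.End.mul_eq_comp, hv, Module.End.one_eq_id]
  refine ⟨v ∘ₗ F, ⟨h₁, hleft, ?_⟩, valg.comp hA hA hA Falg⟩
  refine LinearMap.ext fun y ↦ ?_
  obtain ⟨x, rfl⟩ := Lbij.2 y
  have hx := LinearMap.congr_fun hleft x
  simp only [LinearMap.comp_apply, LinearMap.id_apply] at hx ⊢
  rw [hx]

end Discharge

end Literature.AlgebraicGeometry.Motives

end
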